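import Mathlib.RingTheory.MvPowerSeries.Substitution
import Summits.ResolutionOfSingularities.ResolutionOfSingularities.Theses.ShadowGame
import Summits.ResolutionOfSingularities.ResolutionOfSingularities.Theorems.ShadowGameWin.Negative.Mirror

/-!
# `ShadowGameWinR` (crux stmt-ResolutionOfSingularities-18182, route `ShadowGame`), negative side —
# part 1: named mirror of the repaired terminal test, B's fixed answers, the position family

The route decl `ShadowGame.ShadowGameWinR` (rev 3) inlines the move generator of rev 2 verbatim
(`clean / bl / mF / dv / tr / step / shadow / play`, already named in
`Theorems/ShadowGameWin/Negative/Mirror.lean`) and a NEW terminal test `Terminal′` with a third clause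
(`clean c = w^A · v + g^p` for a formal system of parameters `w`, a unit `v`, some `p ∤ A_j`).  Here:
* `TerminalR`, `AWinsR` — the named mirror, with `shadowGameWinR_iff : ShadowGameWinR ↔ ∀ p prime,
  ∀ n ≥ 1, AWinsR p n` by `Iff.rfl`;
* the bridge `ser / fn` between coefficient functions `(Fin n → ℕ) → κ` and `MvPowerSeries (Fin n) κ`;
* B's FIXED answers in `SG^R_p(3)` (`chartR`: chart `x` if allowed, else `z`, else `y`; `tauR`:
  translate `z` by `1`, nothing else), the substitution `substMap F i τ` realising a move, the position
  family `posSt p a e b U E = x · Π^p · E^p`, `Π = PiSt a e b U = x^a z^{2e} U y² − x^b W³`,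
  `W = Wp = z − x − x z`, the start `c0R`, and B's simulation `runR` of the play with the induced chart
  sequence `iSeqR` (`play = runR`: `play_eq_runR`).
Part 2 (the stubs `ShadowGameShadowGameWinRStub*.lean`), part 3 (the certificate) and the refutation
`Theorems/ShadowGameShadowGameWinRRefutation.lean` build on this file.
Lead prover-line-stmt-ResolutionOfSingularities-18182-0, 2026-08-17.
-/

noncomputable section

set_option linter.dupNamespace false

namespace Summit.ResolutionOfSingularities.ResolutionOfSingularities.Theorems.ShadowGameWinR.Negative

open Summit.ResolutionOfSingularities.ResolutionOfSingularities.Theses.ShadowGame (ShadowGameWinR)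
open Summit.ResolutionOfSingularities.ResolutionOfSingularities.Theorems.ShadowGameWin.Negative
  (clean bl mF dv tr step shadow play play_succ)
open MvPowerSeries

section Mirror

variable {n : ℕ} {κ : Type} [Field κ] (p : ℕ)

/-- The rev-3 terminal test `Terminal′` of `ShadowGameWinR` (verbatim body; `clean` named):
cleaned series zero, OR a monomial of degree `≤ 1`, OR a unique minimal exponent, OR
`clean c = w^A · v + g^p` coefficientwise for a formal regular system of parameters `w`, an exponent
`A` with some `p ∤ A_j`, a unit `v` and a series `g`. [folklore] -/
def TerminalR (c : (Fin n → ℕ) → κ) : Prop :=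
  (∀ A, clean p c A = 0) ∨
  (∃ A, clean p c A ≠ 0 ∧ (Finset.sum Finset.univ (fun j => A j) ≤ 1 ∨
    ∀ B, clean p c B ≠ 0 → ∀ j, A j ≤ B j)) ∨
  ∃ (w : Fin n → MvPowerSeries (Fin n) κ) (A : Fin n → ℕ) (v g : MvPowerSeries (Fin n) κ),
    Ideal.span (Set.range w) = IsLocalRing.maximalIdeal (MvPowerSeries (Fin n) κ) ∧
    (∃ j, ¬ p ∣ A j) ∧ IsUnit v ∧
    ∀ B : Fin n →₀ ℕ, clean p c ⇑B =
      MvPowerSeries.coeff B (Finset.prod Finset.univ (fun j => w j ^ A j) * v + g ^ p)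

end Mirror

/-- `A wins SG^R_p(n)`: the inner statement of `ShadowGameWinR` at `(p, n)`. [folklore] -/
def AWinsR (p n : ℕ) : Prop :=
  ∃ strat : List (Set (Fin n → ℚ)) → List (Fin n) → Finset (Fin n),
    (∀ hs js, (strat hs js).Nonempty) ∧
    ∀ (κ : Type) [Field κ] [CharP κ p] [PerfectField κ] (c₀ : (Fin n → ℕ) → κ) (i : ℕ → Fin n)
      (t : ℕ → Fin n → κ),
      (∀ m, i m ∈ strat (play p strat c₀ i t m).2.1 (play p strat c₀ i t m).2.2) →
        ∃ m, TerminalR p (play p strat c₀ i t m).1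

/-- The route decl is, definitionally, `∀ p prime, ∀ n ≥ 1, AWinsR p n`. [folklore] -/
theorem shadowGameWinR_iff : ShadowGameWinR ↔ ∀ p : ℕ, p.Prime → ∀ n : ℕ, 0 < n → AWinsR p n :=
  Iff.rfl

/-! ## Coefficient functions vs. `MvPowerSeries` -/

section Bridge

variable {n : ℕ} {κ : Type} [Field κ]

/-- A coefficient function as a formal power series. [folklore] -/
def ser (c : (Fin n → ℕ) → κ) : MvPowerSeries (Fin n) κ := fun d => c ⇑d

/-- A formal power series as a coefficient function. [folklore] -/
def fn (f : MvPowerSeries (Fin n) κ) : (Fin n → ℕ) → κ :=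
  fun A => MvPowerSeries.coeff (Finsupp.equivFunOnFinite.symm A) f

/-- `fn ∘ ser = id`. [folklore] -/
theorem fn_ser (c : (Fin n → ℕ) → κ) : fn (ser c) = c := by
  funext A
  show (ser c) (Finsupp.equivFunOnFinite.symm A) = c A
  simp [ser]

/-- `ser ∘ fn = id`. [folklore] -/
theorem ser_fn (f : MvPowerSeries (Fin n) κ) : ser (fn f) = f := by
  funext d
  show f (Finsupp.equivFunOnFinite.symm ⇑d) = f d
  simp

/-- `fn f` evaluated at the exponent function of a finsupp is the coefficient. [folklore] -/
theorem fn_apply_coe (f : MvPowerSeries (Fin n) κ) (d : Fin n →₀ ℕ) :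
    fn f ⇑d = MvPowerSeries.coeff d f := by
  show f (Finsupp.equivFunOnFinite.symm ⇑d) = f d
  simp

end Bridge

/-! ## B's fixed answers and the position family (`n = 3`) -/

section Family

variable {κ : Type} [Field κ]

/-- B's chart: `x` if allowed, else `z` if allowed, else `y`. [folklore] -/
def chartR (F : Finset (Fin 3)) : Fin 3 :=
  if (0 : Fin 3) ∈ F then 0 else if (2 : Fin 3) ∈ F then 2 else 1

variable (κ) in
/-- B's translation (constant in time): `τ_z = 1`, `τ_x = τ_y = 0`. [folklore] -/
def tauR : Fin 3 → κ := fun j => if j = 2 then 1 else 0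

/-- The edge coordinate `W = z − x − x z`; with `y = 0` it cuts out the curve `z = x/(1−x)` that B
follows (all Taylor coefficients `1`: never a coordinate axis in any of B's charts). [folklore] -/
def Wp : MvPowerSeries (Fin 3) κ := X 2 - X 0 - X 0 * X 2

/-- The surface `Π(a,e,b,U) = x^a z^{2e} U y² − x^b W³` (cuspidal edge along `y = W = 0`).
[folklore] -/
def PiSt (a e b : ℕ) (U : MvPowerSeries (Fin 3) κ) : MvPowerSeries (Fin 3) κ :=
  X 0 ^ a * X 2 ^ (2 * e) * U * X 1 ^ 2 - X 0 ^ b * Wp ^ 3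

/-- The position `x · Π^p · E^p` (`E` a unit). [folklore] -/
def posSt (p a e b : ℕ) (U E : MvPowerSeries (Fin 3) κ) : MvPowerSeries (Fin 3) κ :=
  X 0 * PiSt a e b U ^ p * E ^ p

/-- The substitution realising B's answer to the centre `F` in the chart `i` with translation `τ`:
`u_i ↦ u_i`, `u_j ↦ u_i (u_j + τ_j)` for `j ∈ F ∖ {i}`, `u_k ↦ u_k` otherwise. [folklore] -/
def substMap (F : Finset (Fin 3)) (i : Fin 3) (τ : Fin 3 → κ) : Fin 3 → MvPowerSeries (Fin 3) κ :=
  fun j => if j = i then X i else if j ∈ F then X i * (X j + C (τ j)) else X j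

variable (κ) in
/-- B's start position: `x · Π₀^p` with `Π₀ = (1 − x)³ y² − W³`, as a coefficient function.
[folklore] -/
def c0R (p : ℕ) : (Fin 3 → ℕ) → κ := fn (posSt p 0 0 0 ((1 - X 0) ^ 3) 1)

variable (κ) in
/-- B's simulation of the play from `c0R` against `strat` (chart `chartR`, translation `tauR`).
[folklore] -/
def runR (p : ℕ) (strat : List (Set (Fin 3 → ℚ)) → List (Fin 3) → Finset (Fin 3)) :
    ℕ → ((Fin 3 → ℕ) → κ) × List (Set (Fin 3 → ℚ)) × List (Fin 3)
  | 0 => (c0R κ p, [shadow p (c0R κ p)], [])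
  | m + 1 =>
    (step p (strat (runR p strat m).2.1 (runR p strat m).2.2)
        (chartR (strat (runR p strat m).2.1 (runR p strat m).2.2)) (tauR κ) (runR p strat m).1,
      (runR p strat m).2.1 ++ [shadow p (step p (strat (runR p strat m).2.1 (runR p strat m).2.2)
        (chartR (strat (runR p strat m).2.1 (runR p strat m).2.2)) (tauR κ) (runR p strat m).1)],
      (runR p strat m).2.2 ++ [chartR (strat (runR p strat m).2.1 (runR p strat m).2.2)])

variable (κ) in
/-- B's chart sequence against `strat`. [folklore] -/
def iSeqR (p : ℕ) (strat : List (Set (Fin 3 → ℚ)) → List (Fin 3) → Finset (Fin 3)) (m : ℕ) :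
    Fin 3 :=
  chartR (strat (runR κ p strat m).2.1 (runR κ p strat m).2.2)

/-- The actual play from `c0R` against B's sequences IS B's simulation. [folklore] -/
theorem play_eq_runR (p : ℕ) (strat : List (Set (Fin 3 → ℚ)) → List (Fin 3) → Finset (Fin 3)) :
    ∀ m, play p strat (c0R κ p) (iSeqR κ p strat) (fun _ => tauR κ) m = runR κ p strat m
  | 0 => rfl
  | m + 1 => by
    rw [play_succ, play_eq_runR p strat m]
    rfl

/-- B's chart is legal: `chartR F ∈ F` whenever `F` is non-empty. [folklore] -/
theorem chartR_mem {F : Finset (Fin 3)} (hF : F.Nonempty) : chartR F ∈ F := by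
  unfold chartR
  split_ifs with h0 h2
  · exact h0
  · exact h2
  · obtain ⟨j, hj⟩ := hF
    fin_cases j
    · exact absurd hj h0
    · exact hj
    · exact absurd hj h2

end Family

end Summit.ResolutionOfSingularities.ResolutionOfSingularities.Theorems.ShadowGameWinR.Negative

end
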